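import Summits.QuantumAdvantage.QuantumAdvantage.Theorems.CubicForrelationNearExactIsExactTwelveLevelFiveCongruences
import Summits.QuantumAdvantage.QuantumAdvantage.Theorems.CubicForrelationNearExactIsExactTwelveLevelFiveGenericDeadAt2932

/-!
# Crux `CubicForrelation.NearExactIsExact` (stmt-QuantumAdvantage-14043) — n = 12 AT `Φ = 29/32`, the rigid level-5 configuration R1:
  PFAFFIAN PARITY of the 4-flat sections of the `−3`-set and the TRANSVERSAL property

Certificate seat `b2b-cforr-cert` (gen 23).  HONEST FRAMING: kernel-checked finite-slice lemmas (standard axioms, no `decide`) about cubic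
Boolean pairs on 12 bits; first half of the exclusion of configuration R1 of `tw22_levelFive_ge2932_rigid` (a level-5 side `W_g = 32u'`
at `Φ = 29/32`, exact off its odd hyperplane `P = x_P ⊕ V`, with residual `e = u' − 2(−1)^f ∈ {σ, −3σ}` on `P`, `σ = (−1)^D`, `D`
quadratic, and `#T = 128` for `T = {x ∈ P : e = −3σ}`).  NO new value of `θ₁₂`; NOT summit progress.  Paper proof:
HOME/b2b-cforr-cert-g23/PROOF-N12-928-L5.md §7 (i)–(iii).

THE ARGUMENT.  Write `B(p,q) = D(0) ⊕ D(p) ⊕ D(q) ⊕ D(p ⊕ q)` for the alternating form of `D` and `Pf(a₀,a₁,a₂,a₃) =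
B(a₁,a₀)B(a₃,a₂) ⊕ B(a₂,a₀)B(a₃,a₁) ⊕ B(a₃,a₀)B(a₂,a₁)` for its Pfaffian.
1. (`r1_sum8`) For `x ∈ P` and periods `a₀,…,a₃ ∈ V` the residual sums to `≡ 0 (mod 8)` over the parametrised 4-flat `x ⊕ ⟨a⟩ ⊂ P`:
   the straddling 5-flat with the extra direction `x_P ⊕ x'` has `Σ e ≡ 0 (mod 8)` (`l5c_flat5`) and its other half lies in `P'`,
   where `e = 0`.
2. (`r1_parity`) On that flat `e = σ − 4σ·1_T`, and `Σ σ ≡ 4·Pf (mod 8)` (`ws_sum4_mod8`, second differences of the quadratic `D` are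
   base-free by `es_second_deriv`); hence `N_T(x; a) = #{ε : x ⊕ ε·a ∈ T} ≡ Pf(a) (mod 2)`.
3. (`r1_noframe_false`, `r1_frame`) If `Pf ≡ 0` on `V⁴` then `T` has even parametrised 4-flat sections in the coset `P`, so by one
   round of wild-point parity (`ws_erm_round`, Reed–Muller distance) `T = ∅` or `#T ≥ 2^{11−3} = 256` — both contradict `#T = 128`.
   So a frame `a₀,…,a₃ ∈ V` with `Pf = 1` exists.
4. (`r1_transversal`) For such a frame every count `N_T(x;a)` (`x ∈ P`) is odd, and double counting (`x ↦ x ⊕ c_ε` permutes `P`,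
   `ws_card_translate`) gives `Σ_{x∈P} N_T(x;a) = 16·#T = 2048 = #P`; hence `N_T(x;a) = 1` for every `x ∈ P`.

References: J. Ax (1964) / R. J. McEliece (1972); MacWilliams–Sloane (1977) Ch. 13 §3, Ch. 15; C. Carlet (2020) §5.2.  Axioms: the
standard three.
-/

set_option linter.dupNamespace false -- D-0017: single-problem summit ⇒ `QuantumAdvantage.QuantumAdvantage` by design

noncomputable section

namespace Summit.QuantumAdvantage.QuantumAdvantage.Theorems.CubicForrelation.NearExactIsExact

open Finset
open Literature.Computability.QuantumComplexity
open Literature.Computability.QuantumComplexity.BuzetChailloux (bxor zeroVec bxor_bxor_cancel_left bxor_zeroVec zeroVec_bxor bxor_comm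
  bxor_self)
open Literature.Computability.QuantumComplexity.DerivativeWalsh (W)

/-! ### 1. Parametrised 4-flats inside the odd hyperplane: `Σ e ≡ 0 (mod 8)` -/

/-- **`Σ e ≡ 0 (mod 8)` on parametrised 4-flats of `P`.**  Cubic `f, g` on 12 bits, `W_g = 32u'`, odd set `x_P ⊕ V`, even set
`x' ⊕ V`, `e = u' − 2(−1)^f = 0` off the odd set: for `x` odd and periods `a₀,…,a₃ ∈ V`, `8 ∣ Σ_ε e(x ⊕ ε·a)` (straddling 5-flat,
`l5c_flat5`, whose `P'`-half vanishes). [this work] -/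
theorem r1_sum8 (f g : (Fin (6 + 6) → Bool) → Bool) (hf : IsDegLeFun 3 f) (hg : IsDegLeFun 3 g)
    (u' : (Fin (6 + 6) → Bool) → ℤ) (hu' : ∀ x, W (fun y => signOf (g y)) x = (2 : ℝ) ^ 5 * (u' x : ℝ))
    (V : Finset (Fin (6 + 6) → Bool)) (xP x' : Fin (6 + 6) → Bool) (h0 : zeroVec ∈ V) (hadd : ∀ a ∈ V, ∀ b ∈ V, bxor a b ∈ V)
    (hS : (univ.filter fun x : Fin (6 + 6) → Bool => Odd (u' x)) = V.image (bxor xP))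
    (hS' : (univ.filter fun x : Fin (6 + 6) → Bool => ¬ Odd (u' x)) = V.image (bxor x'))
    (hoff : ∀ y, ¬ Odd (u' y) → u' y = 2 * sZ (f y))
    (x : Fin (6 + 6) → Bool) (hx : Odd (u' x)) (a : Fin 4 → Fin (6 + 6) → Bool) (ha : ∀ i, a i ∈ V) :
    (8 : ℤ) ∣ ∑ ε : Fin 4 → Bool, (u' (fun j => x j ^^ decide (Odd #(univ.filter fun i => ε i && a i j))) - 2 * sZ (f (fun j => x j ^^ decide (Odd #(univ.filter fun i => ε i && a i j))))) := by
  classical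
  set e : (Fin (6 + 6) → Bool) → ℤ := fun x => u' x - 2 * sZ (f x) with hedef
  have hmemP : ∀ x, x ∈ V.image (bxor xP) ↔ Odd (u' x) := fun x => by rw [← hS]; simp
  have hmemP' : ∀ x, x ∈ V.image (bxor x') ↔ ¬ Odd (u' x) := fun x => by rw [← hS']; simp
  have hPV' : ∀ x, x ∈ V.image (bxor x') → ∀ a ∈ V, bxor x a ∈ V.image (bxor x') :=
    fun x hx a ha => fl1_coset_vadd hadd rfl hx ha
  set w := bxor xP x' with hwdef
  have hxw : bxor x w ∈ V.image (bxor x') := by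
    obtain ⟨v, hv, rfl⟩ := mem_image.1 ((hmemP x).2 hx)
    have : bxor (bxor xP v) w = bxor x' v := by
      funext j; simp only [bxor, w]; cases xP j <;> cases v j <;> cases x' j <;> rfl
    rw [this]; exact mem_image.2 ⟨v, hv, rfl⟩
  have h5 := l5c_flat5 f g hf hg u' hu' x (Fin.cons w a)
  change (8 : ℤ) ∣ ∑ ε : Fin (4 + 1) → Bool, e (fun j => x j ^^ decide (Odd #(univ.filter fun i : Fin (4 + 1) =>
      ε i && (Fin.cons w a : Fin (4 + 1) → Fin (6 + 6) → Bool) i j))) at h5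
  rw [l5c_sum_split e x w a] at h5
  have hhalf' : ∑ ε : Fin 4 → Bool, e (fun j => bxor x w j ^^ decide (Odd #(univ.filter fun i => ε i && a i j))) = 0 := by
    refine sum_eq_zero fun ε _ => ?_
    have hm := ws_flatPt_mem V h0 (fun z => z ∈ V.image (bxor x')) hPV' 4 (bxor x w) hxw a ha ε
    have h := hoff _ ((hmemP' _).1 hm)
    simp only [e]; omega
  rw [hhalf', add_zero] at h5
  exact h5

/-! ### 2. Pfaffian parity of the 4-flat sections of `T` -/

/-- **Pfaffian parity.**  In configuration R1 (`e ∈ {σ, −3σ}` on the odd set, `σ = (−1)^D`, `D` quadratic, `e = 0` off it): for `x` odd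
and periods `a₀,…,a₃ ∈ V`, the number of `ε ∈ 𝔽₂⁴` with `x ⊕ ε·a ∈ T = {e = −3σ}` is even iff the Pfaffian `Pf(a₀,…,a₃)` of the
alternating form `B(p,q) = D(0) ⊕ D(p) ⊕ D(q) ⊕ D(p⊕q)` vanishes (`Σ e ≡ 0`, `Σ σ ≡ 4·Pf (mod 8)`). [this work] -/
theorem r1_parity (f g : (Fin (6 + 6) → Bool) → Bool) (hf : IsDegLeFun 3 f) (hg : IsDegLeFun 3 g)
    (u' : (Fin (6 + 6) → Bool) → ℤ) (hu' : ∀ x, W (fun y => signOf (g y)) x = (2 : ℝ) ^ 5 * (u' x : ℝ))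
    (V : Finset (Fin (6 + 6) → Bool)) (xP x' : Fin (6 + 6) → Bool) (h0 : zeroVec ∈ V) (hadd : ∀ a ∈ V, ∀ b ∈ V, bxor a b ∈ V)
    (hS : (univ.filter fun x : Fin (6 + 6) → Bool => Odd (u' x)) = V.image (bxor xP))
    (hS' : (univ.filter fun x : Fin (6 + 6) → Bool => ¬ Odd (u' x)) = V.image (bxor x'))
    (hoff : ∀ y, ¬ Odd (u' y) → u' y = 2 * sZ (f y))
    (D : (Fin (6 + 6) → Bool) → Bool) (hD : IsDegLeFun 2 D)
    (hvals : ∀ x, Odd (u' x) → u' x - 2 * sZ (f x) = sZ (D x) ∨ u' x - 2 * sZ (f x) = -3 * sZ (D x))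
    {x a₀ a₁ a₂ a₃ : Fin (6 + 6) → Bool} (hx : Odd (u' x)) (ha₀ : a₀ ∈ V) (ha₁ : a₁ ∈ V) (ha₂ : a₂ ∈ V) (ha₃ : a₃ ∈ V) :
    Even #(univ.filter fun ε : Fin 4 → Bool => u' (fun j => x j ^^ decide (Odd #(univ.filter fun i => ε i && (![a₀, a₁, a₂, a₃] : Fin 4 → Fin (6 + 6) → Bool) i j))) - 2 * sZ (f (fun j => x j ^^ decide (Odd #(univ.filter fun i => ε i && (![a₀, a₁, a₂, a₃] : Fin 4 → Fin (6 + 6) → Bool) i j)))) = -3 * sZ (D (fun j => x j ^^ decide (Odd #(univ.filter fun i => ε i && (![a₀, a₁, a₂, a₃] : Fin 4 → Fin (6 + 6) → Bool) i j))))) ↔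
      ((((D zeroVec ^^ D a₁ ^^ D a₀ ^^ D (bxor a₁ a₀)) && (D zeroVec ^^ D a₃ ^^ D a₂ ^^ D (bxor a₃ a₂))) ^^ ((D zeroVec ^^ D a₂ ^^ D a₀ ^^ D (bxor a₂ a₀)) && (D zeroVec ^^ D a₃ ^^ D a₁ ^^ D (bxor a₃ a₁))) ^^ ((D zeroVec ^^ D a₃ ^^ D a₀ ^^ D (bxor a₃ a₀)) && (D zeroVec ^^ D a₂ ^^ D a₁ ^^ D (bxor a₂ a₁))))) = false := by
  classical
  set e : (Fin (6 + 6) → Bool) → ℤ := fun x => u' x - 2 * sZ (f x) with hedef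
  have hmemP : ∀ x, x ∈ V.image (bxor xP) ↔ Odd (u' x) := fun x => by rw [← hS]; simp
  have hPV : ∀ x, x ∈ V.image (bxor xP) → ∀ a ∈ V, bxor x a ∈ V.image (bxor xP) :=
    fun x hx a ha => fl1_coset_vadd hadd rfl hx ha
  have ha : ∀ i, (![a₀, a₁, a₂, a₃] : Fin 4 → Fin (6 + 6) → Bool) i ∈ V := by
    intro i; fin_cases i <;> assumption
  have hptP : ∀ ε : Fin 4 → Bool, Odd (u' (fun j => x j ^^ decide (Odd #(univ.filter fun i => ε i && (![a₀, a₁, a₂, a₃] : Fin 4 → Fin (6 + 6) → Bool) i j)))) := fun ε =>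
    (hmemP _).1 (ws_flatPt_mem V h0 (fun z => z ∈ V.image (bxor xP)) hPV 4 x ((hmemP x).2 hx) _ ha ε)
  show Even #(univ.filter fun ε : Fin 4 → Bool => e (fun j => x j ^^ decide (Odd #(univ.filter fun i => ε i && (![a₀, a₁, a₂, a₃] : Fin 4 → Fin (6 + 6) → Bool) i j))) = -3 * sZ (D (fun j => x j ^^ decide (Odd #(univ.filter fun i => ε i && (![a₀, a₁, a₂, a₃] : Fin 4 → Fin (6 + 6) → Bool) i j))))) ↔ _
  -- `Σ e ≡ 0 (mod 8)` over the flat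
  have h8 := r1_sum8 f g hf hg u' hu' V xP x' h0 hadd hS hS' hoff x hx _ ha
  change (8 : ℤ) ∣ ∑ ε : Fin 4 → Bool, e (fun j => x j ^^ decide (Odd #(univ.filter fun i => ε i && (![a₀, a₁, a₂, a₃] : Fin 4 → Fin (6 + 6) → Bool) i j))) at h8
  -- `Σ σ ≡ 4·Pf (mod 8)` over the flat (second differences of the quadratic `D` are base-free)
  have hsd : ∀ z : Fin (6 + 6) → Bool, True → ∀ p ∈ V, ∀ q ∈ V, D (bxor (bxor z p) q) =
      (D z ^^ D (bxor z p) ^^ D (bxor z q) ^^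
        (D zeroVec ^^ D (bxor zeroVec p) ^^ D (bxor zeroVec q) ^^ D (bxor (bxor zeroVec p) q))) := by
    intro z _ p _ q _
    rw [es_second_deriv D hD z p q, zeroVec_bxor, zeroVec_bxor]
  have hws := ws_sum4_mod8 V (fun _ => True) zeroVec D (fun _ _ _ _ => trivial) hsd (x := x) trivial ha₀ ha₁ ha₂ ha₃
  simp only [zeroVec_bxor] at hws
  -- pointwise: `e = σ − 4·[T] + 8·[T ∧ D]` on the flat
  have hdec : ∀ ε : Fin 4 → Bool, e (fun j => x j ^^ decide (Odd #(univ.filter fun i => ε i && (![a₀, a₁, a₂, a₃] : Fin 4 → Fin (6 + 6) → Bool) i j))) = sZ (D (fun j => x j ^^ decide (Odd #(univ.filter fun i => ε i && (![a₀, a₁, a₂, a₃] : Fin 4 → Fin (6 + 6) → Bool) i j)))) - 4 * (if e (fun j => x j ^^ decide (Odd #(univ.filter fun i => ε i && (![a₀, a₁, a₂, a₃] : Fin 4 → Fin (6 + 6) → Bool) i j))) = -3 * sZ (D (fun j => x j ^^ decide (Odd #(univ.filter fun i => ε i && (![a₀, a₁, a₂, a₃] : Fin 4 → Fin (6 + 6)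 → Bool) i j)))) then 1 else 0) +
      8 * (if e (fun j => x j ^^ decide (Odd #(univ.filter fun i => ε i && (![a₀, a₁, a₂, a₃] : Fin 4 → Fin (6 + 6) → Bool) i j))) = -3 * sZ (D (fun j => x j ^^ decide (Odd #(univ.filter fun i => ε i && (![a₀, a₁, a₂, a₃] : Fin 4 → Fin (6 + 6) → Bool) i j)))) ∧ D (fun j => x j ^^ decide (Odd #(univ.filter fun i => ε i && (![a₀, a₁, a₂, a₃] : Fin 4 → Fin (6 + 6) → Bool) i j))) = true then 1 else 0) := by
    intro ε
    have hs : sZ (D (fun j => x j ^^ decide (Odd #(univ.filter fun i => ε i && (![a₀, a₁, a₂, a₃] : Fin 4 → Fin (6 + 6) → Bool) i j)))) = 1 ∨ sZ (D (fun j => x j ^^ decide (Odd #(univ.filter fun i => ε i && (![a₀, a₁, a₂, a₃] : Fin 4 → Fin (6 + 6) → Bool) i j)))) = -1 := by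
      cases D (fun j => x j ^^ decide (Odd #(univ.filter fun i => ε i && (![a₀, a₁, a₂, a₃] : Fin 4 → Fin (6 + 6) → Bool) i j))) <;> simp [sZ]
    rcases hvals _ (hptP ε) with h | h
    · have h1 : e (fun j => x j ^^ decide (Odd #(univ.filter fun i => ε i && (![a₀, a₁, a₂, a₃] : Fin 4 → Fin (6 + 6) → Bool) i j))) = sZ (D (fun j => x j ^^ decide (Odd #(univ.filter fun i => ε i && (![a₀, a₁, a₂, a₃] : Fin 4 → Fin (6 + 6) → Bool) i j)))) := h
      have hne : ¬ e (fun j => x j ^^ decide (Odd #(univ.filter fun i => ε i && (![a₀, a₁, a₂, a₃] : Fin 4 → Fin (6 + 6) → Bool) i j))) = -3 * sZ (D (fun j => x j ^^ decide (Odd #(univ.filter fun i => ε i && (![a₀, a₁, a₂, a₃] : Fin 4 → Fin (6 + 6) → Bool) i j)))) := by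
        intro h'
        rcases hs with hs | hs <;> rw [hs] at h1 h' <;> omega
      rw [if_neg hne, if_neg (fun h' => hne h'.1)]
      omega
    · have heq : e (fun j => x j ^^ decide (Odd #(univ.filter fun i => ε i && (![a₀, a₁, a₂, a₃] : Fin 4 → Fin (6 + 6) → Bool) i j))) = -3 * sZ (D (fun j => x j ^^ decide (Odd #(univ.filter fun i => ε i && (![a₀, a₁, a₂, a₃] : Fin 4 → Fin (6 + 6) → Bool) i j)))) := h
      rw [if_pos heq]
      by_cases hDt : D (fun j => x j ^^ decide (Odd #(univ.filter fun i => ε i && (![a₀, a₁, a₂, a₃] : Fin 4 → Fin (6 + 6) → Bool) i j))) = true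
      · rw [if_pos ⟨heq, hDt⟩, heq, hDt]; simp [sZ]
      · rw [if_neg (fun h' => hDt h'.2), heq]
        rw [Bool.not_eq_true] at hDt
        rw [hDt]; simp [sZ]
  have hsum : ∑ ε : Fin 4 → Bool, e (fun j => x j ^^ decide (Odd #(univ.filter fun i => ε i && (![a₀, a₁, a₂, a₃] : Fin 4 → Fin (6 + 6) → Bool) i j))) = ∑ ε : Fin 4 → Bool, sZ (D (fun j => x j ^^ decide (Odd #(univ.filter fun i => ε i && (![a₀, a₁, a₂, a₃] : Fin 4 → Fin (6 + 6) → Bool) i j)))) -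
      4 * (#(univ.filter fun ε : Fin 4 → Bool => e (fun j => x j ^^ decide (Odd #(univ.filter fun i => ε i && (![a₀, a₁, a₂, a₃] : Fin 4 → Fin (6 + 6) → Bool) i j))) = -3 * sZ (D (fun j => x j ^^ decide (Odd #(univ.filter fun i => ε i && (![a₀, a₁, a₂, a₃] : Fin 4 → Fin (6 + 6) → Bool) i j))))) : ℤ) +
      8 * ∑ ε : Fin 4 → Bool, (if e (fun j => x j ^^ decide (Odd #(univ.filter fun i => ε i && (![a₀, a₁, a₂, a₃] : Fin 4 → Fin (6 + 6) → Bool) i j))) = -3 * sZ (D (fun j => x j ^^ decide (Odd #(univ.filter fun i => ε i && (![a₀, a₁, a₂, a₃] : Fin 4 → Fin (6 + 6) → Bool) i j)))) ∧ D (fun j => x j ^^ decide (Odd #(univ.filter fun i => ε i && (![a₀, a₁, a₂, a₃] : Fin 4 → Fin (6 + 6) → Bool) i j))) = true then (1 : ℤ) else 0) := by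
    rw [sum_congr rfl fun ε _ => hdec ε, sum_add_distrib, sum_sub_distrib, ← mul_sum, ← mul_sum, sum_boole]
  rw [hsum] at h8
  obtain ⟨q, hq⟩ := h8
  rcases Bool.eq_false_or_eq_true ((((D zeroVec ^^ D a₁ ^^ D a₀ ^^ D (bxor a₁ a₀)) && (D zeroVec ^^ D a₃ ^^ D a₂ ^^ D (bxor a₃ a₂))) ^^ ((D zeroVec ^^ D a₂ ^^ D a₀ ^^ D (bxor a₂ a₀)) && (D zeroVec ^^ D a₃ ^^ D a₁ ^^ D (bxor a₃ a₁))) ^^ ((D zeroVec ^^ D a₃ ^^ D a₀ ^^ D (bxor a₃ a₀)) && (D zeroVec ^^ D a₂ ^^ D a₁ ^^ D (bxor a₂ a₁))))) with hPf | hPf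
  · rw [hPf] at hws ⊢
    rw [if_pos rfl] at hws
    refine ⟨fun hE => ?_, fun h => absurd h (by decide)⟩
    obtain ⟨r, hr⟩ := hE
    omega
  · rw [hPf] at hws ⊢
    rw [if_neg (by decide)] at hws
    refine ⟨fun _ => rfl, fun _ => ⟨#(univ.filter fun ε : Fin 4 → Bool => e (fun j => x j ^^ decide (Odd #(univ.filter fun i => ε i && (![a₀, a₁, a₂, a₃] : Fin 4 → Fin (6 + 6) → Bool) i j))) = -3 * sZ (D (fun j => x j ^^ decide (Odd #(univ.filter fun i => ε i && (![a₀, a₁, a₂, a₃] : Fin 4 → Fin (6 + 6) → Bool) i j))))) / 2, ?_⟩⟩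
    omega

/-! ### 3. A frame with `Pf = 1` exists -/

/-- **No frame ⇒ contradiction.**  In configuration R1 with `#T = 128`: if the Pfaffian vanished on all quadruples of periods, `T` would
have even parametrised 4-flat sections inside the coset `P` (`r1_parity`), so by one round of wild-point parity (`ws_erm_round`:
generalized Reed–Muller distance) `T = ∅` or `#T ≥ 256`. [this work] -/
theorem r1_noframe_false (f g : (Fin (6 + 6) → Bool) → Bool) (hf : IsDegLeFun 3 f) (hg : IsDegLeFun 3 g)
    (u' : (Fin (6 + 6) → Bool) → ℤ) (hu' : ∀ x, W (fun y => signOf (g y)) x = (2 : ℝ) ^ 5 * (u' x : ℝ))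
    (V : Finset (Fin (6 + 6) → Bool)) (xP x' : Fin (6 + 6) → Bool) (h0 : zeroVec ∈ V) (hadd : ∀ a ∈ V, ∀ b ∈ V, bxor a b ∈ V)
    (hS : (univ.filter fun x : Fin (6 + 6) → Bool => Odd (u' x)) = V.image (bxor xP))
    (hS' : (univ.filter fun x : Fin (6 + 6) → Bool => ¬ Odd (u' x)) = V.image (bxor x'))
    (hoff : ∀ y, ¬ Odd (u' y) → u' y = 2 * sZ (f y))
    (hcardV : #V = 2 ^ 11)
    (D : (Fin (6 + 6) → Bool) → Bool) (hD : IsDegLeFun 2 D)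
    (hvals : ∀ x, Odd (u' x) → u' x - 2 * sZ (f x) = sZ (D x) ∨ u' x - 2 * sZ (f x) = -3 * sZ (D x))
    (hT : #(univ.filter fun x : Fin (6 + 6) → Bool => Odd (u' x) ∧ u' x - 2 * sZ (f x) = -3 * sZ (D x)) = 128)
    (hno : ∀ a₀ ∈ V, ∀ a₁ ∈ V, ∀ a₂ ∈ V, ∀ a₃ ∈ V,
      ((((D zeroVec ^^ D a₁ ^^ D a₀ ^^ D (bxor a₁ a₀)) && (D zeroVec ^^ D a₃ ^^ D a₂ ^^ D (bxor a₃ a₂))) ^^ ((D zeroVec ^^ D a₂ ^^ D a₀ ^^ D (bxor a₂ a₀)) && (D zeroVec ^^ D a₃ ^^ D a₁ ^^ D (bxor a₃ a₁))) ^^ ((D zeroVec ^^ D a₃ ^^ D a₀ ^^ D (bxor a₃ a₀)) && (D zeroVec ^^ D a₂ ^^ D a₁ ^^ D (bxor a₂ a₁))))) = false) : False := by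
  classical
  set e : (Fin (6 + 6) → Bool) → ℤ := fun x => u' x - 2 * sZ (f x) with hedef
  have hmemP : ∀ x, x ∈ V.image (bxor xP) ↔ Odd (u' x) := fun x => by rw [← hS]; simp
  set ψ : (Fin (6 + 6) → Bool) → ℤ := fun z => if e z = -3 * sZ (D z) then 1 else 0 with hψdef
  have H : ∀ b ∈ V.image (bxor xP), ∀ a : Fin (3 + 1) → Fin (6 + 6) → Bool, (∀ i, a i ∈ V) →
      (2 : ℤ) ∣ ∑ ε : Fin (3 + 1) → Bool, ψ (fun j => b j ^^ decide (Odd #(univ.filter fun i => ε i && a i j))) := by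
    intro b hb a ha
    have ea : a = ![a 0, a 1, a 2, a 3] := by funext i; fin_cases i <;> rfl
    have hE := (r1_parity f g hf hg u' hu' V xP x' h0 hadd hS hS' hoff D hD hvals ((hmemP b).1 hb) (ha 0) (ha 1) (ha 2) (ha 3)).2
      (hno _ (ha 0) _ (ha 1) _ (ha 2) _ (ha 3))
    rw [← ea] at hE
    have hs : ∑ ε : Fin (3 + 1) → Bool, ψ (fun j => b j ^^ decide (Odd #(univ.filter fun i => ε i && a i j))) =
        (#(univ.filter fun ε : Fin 4 → Bool => e (fun j => b j ^^ decide (Odd #(univ.filter fun i => ε i && a i j))) = -3 * sZ (D (fun j => b j ^^ decide (Odd #(univ.filter fun i => ε i && a i j))))) : ℤ) := by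
      simp only [ψ]; rw [sum_boole]
    rw [hs]
    exact_mod_cast even_iff_two_dvd.1 hE
  rcases ws_erm_round V h0 hadd hcardV xP ψ 3 H with hall | hbig
  · have hem : (univ.filter fun x : Fin (6 + 6) → Bool => Odd (u' x) ∧ u' x - 2 * sZ (f x) = -3 * sZ (D x)) = ∅ := by
      refine filter_eq_empty_iff.2 fun z _ hz => ?_
      have h := hall z ((hmemP z).2 hz.1)
      have h1 : ψ z = 1 := by simp only [ψ]; rw [if_pos hz.2]
      rw [h1] at h
      exact Int.not_even_one h
    rw [hem, card_empty] at hT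
    exact absurd hT (by norm_num)
  · have hfe : ((V.image (bxor xP)).filter fun z => Odd (ψ z)) = (univ.filter fun x : Fin (6 + 6) → Bool => Odd (u' x) ∧ u' x - 2 * sZ (f x) = -3 * sZ (D x)) := by
      ext z
      rw [mem_filter, mem_filter, hmemP]
      constructor
      · rintro ⟨h1, h2⟩
        refine ⟨mem_univ _, h1, ?_⟩
        by_contra hne
        have h0' : ψ z = 0 := by simp only [ψ]; rw [if_neg hne]
        rw [h0'] at h2
        exact (Int.not_odd_iff_even.2 (even_iff_two_dvd.2 (dvd_zero 2))) h2
      · rintro ⟨-, h1, h2⟩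
        refine ⟨h1, ?_⟩
        have h1' : ψ z = 1 := by simp only [ψ]; rw [if_pos h2]
        rw [h1']
        exact odd_one
    rw [hfe, hT] at hbig
    norm_num at hbig

/-- **A frame exists**: in configuration R1 with `#T = 128` there are periods `a₀,…,a₃ ∈ V` with `Pf(a₀,…,a₃) = 1`. [this work] -/
theorem r1_frame (f g : (Fin (6 + 6) → Bool) → Bool) (hf : IsDegLeFun 3 f) (hg : IsDegLeFun 3 g)
    (u' : (Fin (6 + 6) → Bool) → ℤ) (hu' : ∀ x, W (fun y => signOf (g y)) x = (2 : ℝ) ^ 5 * (u' x : ℝ))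
    (V : Finset (Fin (6 + 6) → Bool)) (xP x' : Fin (6 + 6) → Bool) (h0 : zeroVec ∈ V) (hadd : ∀ a ∈ V, ∀ b ∈ V, bxor a b ∈ V)
    (hS : (univ.filter fun x : Fin (6 + 6) → Bool => Odd (u' x)) = V.image (bxor xP))
    (hS' : (univ.filter fun x : Fin (6 + 6) → Bool => ¬ Odd (u' x)) = V.image (bxor x'))
    (hoff : ∀ y, ¬ Odd (u' y) → u' y = 2 * sZ (f y))
    (hcardV : #V = 2 ^ 11)
    (D : (Fin (6 + 6) → Bool) → Bool) (hD : IsDegLeFun 2 D)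
    (hvals : ∀ x, Odd (u' x) → u' x - 2 * sZ (f x) = sZ (D x) ∨ u' x - 2 * sZ (f x) = -3 * sZ (D x))
    (hT : #(univ.filter fun x : Fin (6 + 6) → Bool => Odd (u' x) ∧ u' x - 2 * sZ (f x) = -3 * sZ (D x)) = 128) :
    ∃ a₀ ∈ V, ∃ a₁ ∈ V, ∃ a₂ ∈ V, ∃ a₃ ∈ V,
      ((((D zeroVec ^^ D a₁ ^^ D a₀ ^^ D (bxor a₁ a₀)) && (D zeroVec ^^ D a₃ ^^ D a₂ ^^ D (bxor a₃ a₂))) ^^ ((D zeroVec ^^ D a₂ ^^ D a₀ ^^ D (bxor a₂ a₀)) && (D zeroVec ^^ D a₃ ^^ D a₁ ^^ D (bxor a₃ a₁))) ^^ ((D zeroVec ^^ D a₃ ^^ D a₀ ^^ D (bxor a₃ a₀)) && (D zeroVec ^^ D a₂ ^^ D a₁ ^^ D (bxor a₂ a₁))))) = true := by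
  by_contra hne
  push Not at hne
  exact r1_noframe_false f g hf hg u' hu' V xP x' h0 hadd hS hS' hoff hcardV D hD hvals hT
    (fun a₀ ha₀ a₁ ha₁ a₂ ha₂ a₃ ha₃ => Bool.eq_false_iff.2 (hne a₀ ha₀ a₁ ha₁ a₂ ha₂ a₃ ha₃))

/-! ### 4. The transversal property -/

/-- **Transversal property.**  In configuration R1 with `#T = 128`, for a frame `a₀,…,a₃ ∈ V` with `Pf = 1`: every parametrised 4-flat
`x ⊕ ⟨a⟩` (`x` odd) meets `T` in EXACTLY ONE parameter `ε` (all counts are odd by `r1_parity`, and they add up to `16·#T = #P` by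
double counting). [this work] -/
theorem r1_transversal (f g : (Fin (6 + 6) → Bool) → Bool) (hf : IsDegLeFun 3 f) (hg : IsDegLeFun 3 g)
    (u' : (Fin (6 + 6) → Bool) → ℤ) (hu' : ∀ x, W (fun y => signOf (g y)) x = (2 : ℝ) ^ 5 * (u' x : ℝ))
    (V : Finset (Fin (6 + 6) → Bool)) (xP x' : Fin (6 + 6) → Bool) (h0 : zeroVec ∈ V) (hadd : ∀ a ∈ V, ∀ b ∈ V, bxor a b ∈ V)
    (hS : (univ.filter fun x : Fin (6 + 6) → Bool => Odd (u' x)) = V.image (bxor xP))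
    (hS' : (univ.filter fun x : Fin (6 + 6) → Bool => ¬ Odd (u' x)) = V.image (bxor x'))
    (hoff : ∀ y, ¬ Odd (u' y) → u' y = 2 * sZ (f y))
    (hPcard : #(univ.filter fun x : Fin (6 + 6) → Bool => Odd (u' x)) = 2048)
    (D : (Fin (6 + 6) → Bool) → Bool) (hD : IsDegLeFun 2 D)
    (hvals : ∀ x, Odd (u' x) → u' x - 2 * sZ (f x) = sZ (D x) ∨ u' x - 2 * sZ (f x) = -3 * sZ (D x))
    (hT : #(univ.filter fun x : Fin (6 + 6) → Bool => Odd (u' x) ∧ u' x - 2 * sZ (f x) = -3 * sZ (D x)) = 128)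
    {a₀ a₁ a₂ a₃ : Fin (6 + 6) → Bool} (ha₀ : a₀ ∈ V) (ha₁ : a₁ ∈ V) (ha₂ : a₂ ∈ V) (ha₃ : a₃ ∈ V)
    (hPf : ((((D zeroVec ^^ D a₁ ^^ D a₀ ^^ D (bxor a₁ a₀)) && (D zeroVec ^^ D a₃ ^^ D a₂ ^^ D (bxor a₃ a₂))) ^^ ((D zeroVec ^^ D a₂ ^^ D a₀ ^^ D (bxor a₂ a₀)) && (D zeroVec ^^ D a₃ ^^ D a₁ ^^ D (bxor a₃ a₁))) ^^ ((D zeroVec ^^ D a₃ ^^ D a₀ ^^ D (bxor a₃ a₀)) && (D zeroVec ^^ D a₂ ^^ D a₁ ^^ D (bxor a₂ a₁))))) = true)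
    (x : Fin (6 + 6) → Bool) (hx : Odd (u' x)) :
    #(univ.filter fun ε : Fin 4 → Bool => u' (fun j => x j ^^ decide (Odd #(univ.filter fun i => ε i && (![a₀, a₁, a₂, a₃] : Fin 4 → Fin (6 + 6) → Bool) i j))) - 2 * sZ (f (fun j => x j ^^ decide (Odd #(univ.filter fun i => ε i && (![a₀, a₁, a₂, a₃] : Fin 4 → Fin (6 + 6) → Bool) i j)))) = -3 * sZ (D (fun j => x j ^^ decide (Odd #(univ.filter fun i => ε i && (![a₀, a₁, a₂, a₃] : Fin 4 → Fin (6 + 6) → Bool) i j))))) = 1 := by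
  classical
  set e : (Fin (6 + 6) → Bool) → ℤ := fun x => u' x - 2 * sZ (f x) with hedef
  have ha : ∀ i, (![a₀, a₁, a₂, a₃] : Fin 4 → Fin (6 + 6) → Bool) i ∈ V := by
    intro i; fin_cases i <;> assumption
  set Pset := univ.filter (fun z : Fin (6 + 6) → Bool => Odd (u' z)) with hPset
  show #(univ.filter fun ε : Fin 4 → Bool => e (fun j => x j ^^ decide (Odd #(univ.filter fun i => ε i && (![a₀, a₁, a₂, a₃] : Fin 4 → Fin (6 + 6) → Bool) i j))) = -3 * sZ (D (fun j => x j ^^ decide (Odd #(univ.filter fun i => ε i && (![a₀, a₁, a₂, a₃] : Fin 4 → Fin (6 + 6) → Bool) i j))))) = 1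
  -- every section count is odd
  have hodd : ∀ z ∈ Pset, Odd #(univ.filter fun ε : Fin 4 → Bool => e (fun j => z j ^^ decide (Odd #(univ.filter fun i => ε i && (![a₀, a₁, a₂, a₃] : Fin 4 → Fin (6 + 6) → Bool) i j))) = -3 * sZ (D (fun j => z j ^^ decide (Odd #(univ.filter fun i => ε i && (![a₀, a₁, a₂, a₃] : Fin 4 → Fin (6 + 6) → Bool) i j))))) := by
    intro z hz
    have hz' : Odd (u' z) := by simpa [Pset] using hz
    have h := r1_parity f g hf hg u' hu' V xP x' h0 hadd hS hS' hoff D hD hvals hz' ha₀ ha₁ ha₂ ha₃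
    rw [hPf] at h
    exact Nat.not_even_iff_odd.1 fun hE => absurd (h.1 hE) (by decide)
  -- the flat points of the origin are periods
  have hc : ∀ ε : Fin 4 → Bool, (fun j => zeroVec j ^^ decide (Odd #(univ.filter fun i => ε i && (![a₀, a₁, a₂, a₃] : Fin 4 → Fin (6 + 6) → Bool) i j))) ∈ V :=
    fun ε => ws_flatPt_mem V h0 (fun z => z ∈ V) (fun z hz b hb => hadd z hz b hb) 4 zeroVec h0 _ ha ε
  -- double counting
  have hsum : ∑ z ∈ Pset, #(univ.filter fun ε : Fin 4 → Bool => e (fun j => z j ^^ decide (Odd #(univ.filter fun i => ε i && (![a₀, a₁, a₂, a₃] : Fin 4 → Fin (6 + 6) → Bool) i j))) = -3 * sZ (D (fun j => z j ^^ decide (Odd #(univ.filter fun i => ε i && (![a₀, a₁, a₂, a₃] : Fin 4 → Fin (6 + 6) → Bool) i j))))) = ∑ z ∈ Pset, 1 := by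
    calc ∑ z ∈ Pset, #(univ.filter fun ε : Fin 4 → Bool => e (fun j => z j ^^ decide (Odd #(univ.filter fun i => ε i && (![a₀, a₁, a₂, a₃] : Fin 4 → Fin (6 + 6) → Bool) i j))) = -3 * sZ (D (fun j => z j ^^ decide (Odd #(univ.filter fun i => ε i && (![a₀, a₁, a₂, a₃] : Fin 4 → Fin (6 + 6) → Bool) i j)))))
        = ∑ z ∈ Pset, ∑ ε : Fin 4 → Bool, (if e (fun j => z j ^^ decide (Odd #(univ.filter fun i => ε i && (![a₀, a₁, a₂, a₃] : Fin 4 → Fin (6 + 6) → Bool) i j))) = -3 * sZ (D (fun j => z j ^^ decide (Odd #(univ.filter fun i => ε i && (![a₀, a₁, a₂, a₃] : Fin 4 → Fin (6 + 6) → Bool) i j)))) then 1 else 0) :=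
          sum_congr rfl fun z _ => by rw [sum_boole, Nat.cast_id]
      _ = ∑ ε : Fin 4 → Bool, ∑ z ∈ Pset, (if e (fun j => z j ^^ decide (Odd #(univ.filter fun i => ε i && (![a₀, a₁, a₂, a₃] : Fin 4 → Fin (6 + 6) → Bool) i j))) = -3 * sZ (D (fun j => z j ^^ decide (Odd #(univ.filter fun i => ε i && (![a₀, a₁, a₂, a₃] : Fin 4 → Fin (6 + 6) → Bool) i j)))) then 1 else 0) := sum_comm
      _ = ∑ ε : Fin 4 → Bool, #(Pset.filter fun z => e (bxor z (fun j => zeroVec j ^^ decide (Odd #(univ.filter fun i => ε i && (![a₀, a₁, a₂, a₃] : Fin 4 → Fin (6 + 6) → Bool) i j)))) = -3 * sZ (D (bxor z (fun j => zeroVec j ^^ decide (Odd #(univ.filter fun i => ε i && (![a₀, a₁, a₂, a₃] : Fin 4 → Fin (6 + 6) → Bool) i j)))))) := by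
          refine sum_congr rfl fun ε _ => ?_
          rw [sum_boole, Nat.cast_id]
          exact congrArg card (filter_congr fun z _ => by rw [ws_flatPt_eq_bxor z _ ε])
      _ = ∑ ε : Fin 4 → Bool, #(Pset.filter fun z => e z = -3 * sZ (D z)) :=
          sum_congr rfl fun ε _ => ws_card_translate V Pset xP hadd hS (hc ε) (fun z => e z = -3 * sZ (D z))
      _ = ∑ ε : Fin 4 → Bool, 128 := by
          refine sum_congr rfl fun ε _ => ?_
          rw [← hT]
          simp only [Pset, filter_filter, e]
      _ = ∑ z ∈ Pset, 1 := by
          rw [sum_const, sum_const, smul_eq_mul, smul_eq_mul, card_univ, Fintype.card_fun, Fintype.card_bool,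
            Fintype.card_fin, hPcard]
          norm_num
  have hle : ∀ z ∈ Pset, 1 ≤ #(univ.filter fun ε : Fin 4 → Bool => e (fun j => z j ^^ decide (Odd #(univ.filter fun i => ε i && (![a₀, a₁, a₂, a₃] : Fin 4 → Fin (6 + 6) → Bool) i j))) = -3 * sZ (D (fun j => z j ^^ decide (Odd #(univ.filter fun i => ε i && (![a₀, a₁, a₂, a₃] : Fin 4 → Fin (6 + 6) → Bool) i j))))) := by
    intro z hz
    rcases hodd z hz with ⟨r, hr⟩
    omega
  have hall := (sum_eq_sum_iff_of_le hle).1 hsum.symm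
  exact (hall x (by simp [Pset, hx])).symm

end Summit.QuantumAdvantage.QuantumAdvantage.Theorems.CubicForrelation.NearExactIsExact

end
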